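import Summits.RiemannHypothesis.RiemannHypothesis.Theses.RuelleBand
import Summits.RiemannHypothesis.RiemannHypothesis.Theorems.ExactFirstBand.Negative.Reformulations
import Literature.NumberTheory.LFunctions.WeilExplicitFormulaProofs
import Literature.NumberTheory.LFunctions.WeilExplicitProofs
import HarnessLib.Audit

/-!
# Line `SketchIdeator1` (even Weil sector), calibration: X ⟹ Weil positivity on the even real sector

Crux `RuelleBand.ExactFirstBand` (stmt-RiemannHypothesis-2061).  The line's single research stub (the bet
`stub_evenWeilPositivity`: `Re W(g ⋆ g̃) ≥ 0` for every even real-valued test function `g`) is implied by the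
crux: X ⟹ RH (`Negative.exactFirstBand_iff_riemannHypothesis`) ⟹ Weil positivity for all test functions
(`WeilPositivity.of_riemannHypothesis` with the PROVED explicit formula `explicit_formula_holds`) ⟹ restrict.
So the bet is at most X-strength (the converse, bet ⟹ X, is the line's closable layer).
-/

noncomputable section

open Complex

namespace Summit.RiemannHypothesis.RiemannHypothesis.Theorems.RuelleBandExactFirstBand

open Summit.RiemannHypothesis.RiemannHypothesis.Theses.RuelleBand
open Literature.NumberTheory.LFunctions

/-- **Calibration of line `SketchIdeator1` (X ⟹ the bet).** If every zero of `ζ` in the open critical strip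
lies on the critical line or the real axis, then `Re W(g ⋆ g̃) ≥ 0` for every smooth compactly supported `g`
that is even and real-valued: X gives RH (`exactFirstBand_iff_riemannHypothesis`), RH gives Weil positivity for
all test functions (`WeilPositivity.of_riemannHypothesis explicit_formula_holds`). -/
theorem stub_evenCalibration :
    ExactFirstBand → ∀ g : ℝ → ℂ, IsWeilTest g → (∀ t : ℝ, g (-t) = g t) → (∀ t : ℝ, (g t).im = 0) →
      0 ≤ (weilQuadratic g).re :=
  fun hX g hg _ _ =>
    WeilPositivity.of_riemannHypothesis explicit_formula_holds
      (Summit.RiemannHypothesis.Cruxes.ExactFirstBand.Negative.exactFirstBand_iff_riemannHypothesis.mp hX) g hg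

end Summit.RiemannHypothesis.RiemannHypothesis.Theorems.RuelleBandExactFirstBand

end
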